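import Summits.Ventures.QEC.CircuitDistance.PortK2DataBB144Z
import Summits.Ventures.QEC.CircuitDistance.K2Chunks
import HarnessLib

/-!
# K2(`[[144,12,12]]`) chunk module — COMPUTATIONAL (native_decide; `Lean.ofReduceBool`)

Cell `qec`, CDX, R146/R152 STEP 1 («computational» header; `ofReduceBool` confined to these chunk modules). Checker of record
`K2.K2Data` (qec-cdx-type-1, PortK2Check); data module of record `PortK2DataBB144X/Z` (p669158/9, crit-1 data audit PASS
2026-08-28T21:20Z); chunk glue `K2Chunks` (idea-1 g2). Cube 1, child 5: leaf group 1 of 3.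
Leaf theorems: the K2 DFS accepts below one descendant state of pivot cube 1 (sector Z); sizes are exact DFS visit counts
(eng-1 g2 `k2count.c`), capped so that the gate's native-axiom audit re-verifies every leaf in place. Assemblies re-derive the
child lists in the kernel (`decide`) and end in the literal cube fact `d144Z.cube (Ts144Z.getD 1 []) (72) (lives144Z.getD 1 0) = true`
(the `hcubes` hypothesis of `K2Inst.k2_complete`). Emitted by qec-cdx-eng-1 g2 (`gen2.py`, idea-1's `gen_k2chunks_from_lean.py` lineage).
-/

namespace Summit.Ventures.QEC.CircuitDistance.K2

set_option maxRecDepth 100000 in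
set_option maxHeartbeats 0 in
set_option exponentiation.threshold 1024 in
/-- K2(144) chunk fact `cube144Z1_ch5_0` (601499 DFS visits; see the module docstring). -/
theorem cube144Z1_ch5_0 : app5 (d144Z.dfs (Ts144Z.getD 1 []) 6) (147573952589677002754, 2560, 5846006549323611672814739940050408368807962738688, 3, 2348542582773833227889480596789337027375682548908319870707282156761255892312260534765634541019538110575280128) = true := by native_decide

set_option maxRecDepth 100000 in
set_option maxHeartbeats 0 in
set_option exponentiation.threshold 1024 in
/-- K2(144) chunk fact `cube144Z1_ch5_1` (541026 DFS visits; see the module docstring). -/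
theorem cube144Z1_ch5_1 : app5 (d144Z.dfs (Ts144Z.getD 1 []) 6) (598032, 0, 5846006549323611672815048820597319906562100166656, 3, 2348542582773833227889480596789337027375682548908319870707282156761255892312260534456149531198193041850499072) = true := by native_decide

set_option maxRecDepth 100000 in
set_option maxHeartbeats 0 in
set_option exponentiation.threshold 1024 in
/-- K2(144) chunk fact `cube144Z1_ch5_2` (1 DFS visits; see the module docstring). -/
theorem cube144Z1_ch5_2 : app5 (d144Z.dfs (Ts144Z.getD 1 []) 6) (0, 0, 5846006549323611672834546376216064645891761373184, 3, 2348542582773833227889480596789337027375682548908319870707282156761255892312260514649108902632108643464511488) = true := by decide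

set_option maxRecDepth 100000 in
set_option maxHeartbeats 0 in
set_option exponentiation.threshold 1024 in
/-- K2(144) chunk fact `cube144Z1_ch5_3` (286945 DFS visits; see the module docstring). -/
theorem cube144Z1_ch5_3 : app5 (d144Z.dfs (Ts144Z.getD 1 []) 6) (148873241082173390850, 2560, 5857424530865259351863205623343094522584437358592, 3, 2348542582773833227889480596789337027375682548908319870707282145343274350664581466182821147036147552402538496) = true := by native_decide

set_option maxRecDepth 100000 in
set_option maxHeartbeats 0 in
set_option exponentiation.threshold 1024 in
/-- K2(144) chunk fact `cube144Z1_ch5_4` (308730 DFS visits; see the module docstring). -/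
theorem cube144Z1_ch5_4 : app5 (d144Z.dfs (Ts144Z.getD 1 []) 6) (591466746261822578704, 0, 5937350401656793105202469637632266250221871169536, 3, 2348542582773833227889480596789337027375682548908319870707282053999422017483149078452519102268458823906754560) = true := by native_decide

set_option maxRecDepth 100000 in
set_option maxHeartbeats 0 in
set_option exponentiation.threshold 1024 in
/-- K2(144) chunk fact `cube144Z1_ch5_5` (328597 DFS visits; see the module docstring). -/
theorem cube144Z1_ch5_5 : app5 (d144Z.dfs (Ts144Z.getD 1 []) 6) (147573952589752631298, 2560, 754134844862745905793101373686324404625330837389312, 3, 2348542582773833227889480596789337027375682548908319870706533765161108595189028791818168365362394986444750848) = true := by native_decide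
end Summit.Ventures.QEC.CircuitDistance.K2
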